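import Summits.QuantumFields.YangMills.Theorems.BalabanUVNodesN05AtRecord13SubBP2CSepCoPH
import Literature.MathematicalPhysics.QuantumFieldTheory.Balaban1983to89.Node00.Record13CarriersB8SubBP2CCoPHG

/-!
# BalabanUVNodes ∕ N05 ([B8], `Dag.B8_main`) AT A `b8`-GENERIC S-CLASS («G-CLASS») RECORD FROM THE «P₂C» SLOT — the G-currency corollary of width seat `pub-ymgap-dag-n05-w4`'s
# slot closer `…N05AtRecord13SubBP2CSepCoPH.exists_isRecordOfRecord₁₃CSepCoPHSB8subBP₂C_b8_of_leaf` (p610956) through width seat `pub-ymgap-dag-n05-w1`'s membership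
# `Node00.isRecordOfRecord₁₃CSepCoPHG_of_isRecordOfRecord₁₃CSepCoPHSB8subBP₂C` (p609997): a proof of the P₂C slot at an admissible v1.7 parameter gives a world IN THE G-CLASS
# `Node00.IsRecordOfRecord₁₃CSepCoPHG` (dag-n05-w4, p607735) at the datum of record with every run's `b8` leaf and `Dag.B8_main`; ∀-currency and ∃λ-currency forms

Track A of `YM-PLAN.md` (cell `pub-ymgap`, HUMAN RULING D-0062 ∕ D-0149 width seats), node **N05** = [Balaban1985RegularSpaces] Lemma 1 p. 79 – Thm 8 p. 101; width seat
`pub-ymgap-dag-n05-w1` (g2), 2026-08-28; key item K1⁷ `StabilityBAtRecordR13SepCoPH` (`--supports`, helper; count-neutral).  The piece worded to this seat by dag-n05-w4 g2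
(cell bus 2026-08-28 06:58Z «the G-currency corollary is YOURS on p609997»).

WHY.  K1⁷'s registered rung texts read the RS class (`RecordS`); the planners' option (b) hosts the «P₂C» repaired-currency worlds in dag-n05-w4's `b8`-generic class
`IsRecordOfRecord₁₃CSepCoPHG` (RS ⊂ G, C ⊂ G, SC pointed), whose END-from-nodes entry is proved once (`endStatementBPrinted_of_isRecordOfRecord₁₃CSepCoPHG_of_nodes`).  The N05
row of a G-keyed engine therefore wants: «from the P₂C slot, a G-class world at the datum of record whose `b8` leaf holds and at which `Dag.B8_main` holds, every run».  This file is
that statement, by name: dag-n05-w4's slot closer at the one-pin P₂C record + this seat's one-pin G-slice.  SLOT-LEVEL ONLY: no [4]-type socket ∕ letters text is displayed here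
(so the vacuity certificate `B8SockLettersRDIdxB8LawsBVacuity`, p613168, does not touch this file); the slot `B8LeafOfRecordSubBP₂C θ.toStage3Params λ` is the HYPOTHESIS.

WHAT IS PROVED (0 def, 3 thm; by-name composition, no estimate):
* §1 ★ `exists_isRecordOfRecord₁₃CSepCoPHG_b8_of_leaf` — admissible `θ : Stage13HParams F N` with v1.7 provisos `h`, a residual [B8] layer `λ`, a proof of the P₂C slot, a window
  `γw ∈ ]0, θ.γ]` ⊢ `∃ w`, `IsRecordOfRecord₁₃CSepCoPHG F N (datumOfRecord₁₃SepCoPH F N θ h) w`, `w.C ∕ w.γ = γw ∕ w.L` displayed, the SC-binding over the [B8″P]-pinned Co view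
  displayed, and `∀ P, (leavesP w P).b8 ∧ Dag.B8_main (leavesP w P)`; `b8_main_at_isRecordOfRecord₁₃CSepCoPHG_pinB8SubBP₂C_of_leaf` (∀-currency: ANY world so bound is a G-class
  record with `b8 ∧ B8_main` at every run).
* §2 `exists_isRecordOfRecord₁₃CSepCoPHG_b8_of_exists_leaf` — the ∃λ-currency adapter (hypothesis `∃ lam, B8LeafOfRecordSubBP₂C θ.toStage3Params lam` = the engine row «h05»
  in the P₂C edition, the conclusion shape of dag-n05-d's ∃λ theorems).
HONEST FRAMING: bookkeeping by name; 0 estimates; the slot is a HYPOTHESIS (Prop. 7 inside it in the repaired currency `c₇OfRecord θ` — WATCH-P7-CURRENCY-RECORD; Prop. 5's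
carriers as the layer chooses them — LOCATED №5 ∕ WATCH-P5-CARRIER-CHOICE); whether a K1⁷ edition reads the G-class is the planners' word; count-neutral; N05 NOT discharged;
K1 NOT claimed; one finite T⁴ programme at fixed ε, Bałaban AS PRINTED — NOT continuum ∕ ℝ⁴ ∕ OS ∕ mass gap ∕ Clay.  No `sorry`, no `instance`, no `notation`.
-/

noncomputable section

namespace Summit.QuantumFields.YangMills.BalabanUVNodes.N05AtRecord13SubBP2CSepCoPHG

open Literature.MathematicalPhysics.QuantumFieldTheory.Balaban1983to89
open Literature.MathematicalPhysics.QuantumFieldTheory.Balaban1983to89.Node00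
open Literature.MathematicalPhysics.QuantumFieldTheory.Balaban1983to89.T4Continuum
open Literature.MathematicalPhysics.QuantumFieldTheory.Balaban1983to89.DagBinding
open Summit.QuantumFields.YangMills.BalabanUVNodes.N05AtRecord13SubBP2CSepCoPH (exists_isRecordOfRecord₁₃CSepCoPHSB8subBP₂C_b8_of_leaf)

/-! ## §1. From the P₂C slot to a G-class world with `b8` and `Dag.B8_main` at every run -/

section Slot

variable {F : T4Family} {N : ℕ} [NeZero N]

/-- ★ **N05 AT A G-CLASS RECORD FROM THE P₂C SLOT**: admissible v1.7 parameters `θ` with provisos `h`, a residual [B8] layer `λ` and a proof of the «P₂C» slot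
`B8LeafOfRecordSubBP₂C θ.toStage3Params λ` give, for every window `γw ∈ ]0, θ.γ]`, a world `w` IN dag-n05-w4's `b8`-GENERIC S-CLASS at the datum of record — `C`, `γ = γw`, `L`
and the SC-binding over the [B8″P]-pinned Co view DISPLAYED — at which every run's `b8` leaf holds and `Dag.B8_main (leavesP w P)` holds (dag-n05-w4's slot closer p610956 §1 +
this seat's G-slice p609997, by name). [cite: Balaban1985RegularSpaces, Lemma 1 p.79 – Thm 8 (1.146) p.101 (the node); Balaban1989LargeFieldII, Thm 1 + (0.1) pp.355–356 (record bookkeeping)] -/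
theorem exists_isRecordOfRecord₁₃CSepCoPHG_b8_of_leaf (θ : Stage13HParams F N) (h : θ.Provisos₁₃SepCoPH F N) (hθ : θ.Admissible F N)
    (lam : ResidB8 θ.toStage3Params) (hleaf : B8LeafOfRecordSubBP₂C θ.toStage3Params lam) {γw : ℝ} (hγ0 : 0 < γw) (hγ1 : γw ≤ θ.γ) :
    ∃ w : WorldP, IsRecordOfRecord₁₃CSepCoPHG F N (datumOfRecord₁₃SepCoPH F N θ h) w ∧
      w.C = (datumOfRecord₁₃SepCoPH F N θ h).C ∧ w.γ = γw ∧ w.L = (θ.L : ℝ) ∧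
      (∀ P : B12.RunParams, w.up P = upOfRecord₅CSC F N ((θ.pinB8SubBP₂C F N lam).toStage5₁₃CoPH F N) (c₇OfRecord θ.toStage3Params) P) ∧
      ∀ P : B12.RunParams, (leavesP w P).b8 ∧ Dag.B8_main (leavesP w P) := by
  obtain ⟨w, -, hrec, hC, hγ, hL, hup, hb8, -⟩ := exists_isRecordOfRecord₁₃CSepCoPHSB8subBP₂C_b8_of_leaf θ h hθ lam hleaf hγ0 hγ1
  exact ⟨w, isRecordOfRecord₁₃CSepCoPHG_of_isRecordOfRecord₁₃CSepCoPHSB8subBP₂C hrec, hC, hγ, hL, hup, hb8⟩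

/-- **∀-currency**: ANY world with def-T's pointed clauses at `θ` bound to the SC-binding over the [B8″P]-pinned Co view at a layer `λ` carrying the P₂C slot IS a G-class record at
the datum of record, with every run's `b8` leaf and `Dag.B8_main` (p609997's pointed membership + the record's `b8` face `upOfRecord₅CSC_toStage5₁₃CoPH_pinB8SubBP₂C_b8_iff` and `b8_b11_b10_main_iff_…` of p607069, by name).
[cite: Balaban1985RegularSpaces, Lemma 1 p.79 – Thm 8 p.101; Balaban1989LargeFieldII, Thm 1 + (0.1) pp.355–356 (bookkeeping)] -/
theorem b8_main_at_isRecordOfRecord₁₃CSepCoPHG_pinB8SubBP₂C_of_leaf (θ : Stage13HParams F N) (h : θ.Provisos₁₃SepCoPH F N) (hθ : θ.Admissible F N)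
    (lam : ResidB8 θ.toStage3Params) (hleaf : B8LeafOfRecordSubBP₂C θ.toStage3Params lam) (w : WorldP)
    (hC : w.C = (datumOfRecord₁₃SepCoPH F N θ h).C) (hγ : 0 < w.γ ∧ w.γ ≤ θ.γ) (hL : w.L = (θ.L : ℝ))
    (hup : ∀ P, w.up P = upOfRecord₅CSC F N ((θ.pinB8SubBP₂C F N lam).toStage5₁₃CoPH F N) (c₇OfRecord θ.toStage3Params) P) :
    IsRecordOfRecord₁₃CSepCoPHG F N (datumOfRecord₁₃SepCoPH F N θ h) w ∧ ∀ P : B12.RunParams, (leavesP w P).b8 ∧ Dag.B8_main (leavesP w P) := by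
  have hrec : IsRecordOfRecord₁₃CSepCoPHSB8subBP₂C F N (datumOfRecord₁₃SepCoPH F N θ h) w := ⟨θ, h, lam, hθ, rfl, hC, hγ, hL, hup⟩
  refine ⟨isRecordOfRecord₁₃CSepCoPHG_pinB8SubBP₂C_of_eq_upSC F N θ h hθ lam w hC hγ hL hup, fun P => ?_⟩
  have hb8 : (leavesP w P).b8 := by
    show (w.up P).b8
    rw [hup P]
    exact (upOfRecord₅CSC_toStage5₁₃CoPH_pinB8SubBP₂C_b8_iff F N θ lam P).2 hleaf
  exact ⟨hb8, (b8_b11_b10_main_iff_of_isRecordOfRecord₁₃CSepCoPHSB8subBP₂C hrec P).1.2 fun _ => hb8⟩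

end Slot

/-! ## §2. The ∃λ-currency adapter (the engine row «h05» in the P₂C edition) -/

section ExistsLeaf

variable {F : T4Family} {N : ℕ} [NeZero N]

/-- **∃λ-CURRENCY ADAPTER**: if SOME residual [B8] layer carries the P₂C slot at `θ.toStage3Params` (the engine row «h05 ↦ ∃ lam8, B8LeafOfRecordSubBP₂C θ₃ lam8», the conclusion shape
of dag-n05-d's ∃λ theorems), then for every window `γw ∈ ]0, θ.γ]` there is a G-CLASS world at the datum of record with `γ = γw`, every run's `b8` leaf and `Dag.B8_main`.  Which Prop-5
carriers ∕ constants the layer chose is NOT displayed here (LOCATED №5 ∕ WATCH-P5-CARRIER-CHOICE: a consumer wanting print's Prop-5 family reads a pinned layer instead).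
[cite: Balaban1985RegularSpaces, Lemma 1 p.79 – Thm 8 p.101; Balaban1989LargeFieldII, Thm 1 + (0.1) pp.355–356 (bookkeeping)] -/
theorem exists_isRecordOfRecord₁₃CSepCoPHG_b8_of_exists_leaf (θ : Stage13HParams F N) (h : θ.Provisos₁₃SepCoPH F N) (hθ : θ.Admissible F N)
    (hex : ∃ lam : ResidB8 θ.toStage3Params, B8LeafOfRecordSubBP₂C θ.toStage3Params lam) {γw : ℝ} (hγ0 : 0 < γw) (hγ1 : γw ≤ θ.γ) :
    ∃ w : WorldP, IsRecordOfRecord₁₃CSepCoPHG F N (datumOfRecord₁₃SepCoPH F N θ h) w ∧ w.γ = γw ∧ w.L = (θ.L : ℝ) ∧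
      ∀ P : B12.RunParams, (leavesP w P).b8 ∧ Dag.B8_main (leavesP w P) := by
  obtain ⟨lam, hleaf⟩ := hex
  obtain ⟨w, hG, -, hγ, hL, -, hb8⟩ := exists_isRecordOfRecord₁₃CSepCoPHG_b8_of_leaf θ h hθ lam hleaf hγ0 hγ1
  exact ⟨w, hG, hγ, hL, hb8⟩

end ExistsLeaf

end Summit.QuantumFields.YangMills.BalabanUVNodes.N05AtRecord13SubBP2CSepCoPHG

end
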